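import Summits.AtomisticToContinuum.HydrodynamicLimit.Theorems.CollisionIsometryCLTCollisionalTransferLocalityDefsE
import Summits.AtomisticToContinuum.HydrodynamicLimit.Theorems.JParityClosureParityBandClosurePressureValueAlgebra
import Literature.MathematicalPhysics.KineticTheory.KineticEntropyBalanceFunctional
import Literature.MathematicalPhysics.KineticTheory.EvenCollisionTubeFunctional
import HarnessLib

/-!
# The macroscale Enskog value integrand IS the line's value integrand on cone-kernel block fields
(registered stub `stub_coneValue_eq`, [ConeVal], line `hemisphere-affine-slaving`,
crux `CollisionalTransferLocality`, stmt-AtomisticToContinuum-9518)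

Deterministic pointwise algebra. For ONE configuration `w` of `N + 1` spheres, one centre `x`, one cone
scale `r > 0` and a matrix weight `A(s, x)`, the right-hand integrand of the landed macroscale identity
`ParityBandClosurePressureValue.sum_enskog_integral_eq` (one half of it: trace part
`g(σ³ρ_r)(p_hs(ρ_r, θ_r) − ρ_rθ_r) tr A` plus traceless part
`(4π/15) (σ³ρ_r)⁺ g Ỹ Σ_jk A⁰_jk (S_jk − m_j m_k/ρ_r)`) equals the value integrand of the line
`g(σ³ρ̄) (tr A · p_c(ρ̄, θ̄) + kinWA · p_c(ρ̄, θ̄))` with the cone kernel `b_r(·, 0)` as block kernel.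

Proof.
* Kernel identification: `b_r(y − x, 0) = b_r(y, x)` (`euclidDist (y − x) 0 = ‖reprSym (y − x)‖`), hence
  `ρ̄ = ρ_r`, `m̄ = m_r`, `Ē = e_r`, `θ̄ = θ_r` for the block kernel `φ_N := b_r(·, 0)`.
* Trace part: definitional (`p_c = p_hs − ρθ`, `trW A = Σ_a A_aa`).
* Traceless part, `ρ_r ≠ 0`: the block central moments are `∫ b (v_j − ū_j)(v_k − ū_k) = S_jk − m_j m_k/ρ_r`
  (`ū = m_r/ρ_r`, finite empirical sums), their trace is `2e_r − ‖m_r‖²/ρ_r = 3 ρ_r θ_r = 3 pkin`, so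
  `D̄_jk = P_jk − pkin δ_jk` and, `A⁰` and `D̄` being traceless, `Σ A⁰_jk P_jk = Σ D̄_ab A_ab`; then
  `p_c = pkin (σ³ρ_r) f_ex′(σ³ρ_r)` and, on the band `0 < σ³ρ_r < η₀' ≤ η₁` where `g ≠ 0`,
  `Ỹ = Y = (3/2π) f_ex′`, `(4π/15)(3/2π) = 2/5`; off the guard `pkin ≠ 0` the factors `pkin/pkin` cancel, on
  the guard `pkin = 0` every diagonal central moment vanishes, hence every `b_i (v_i − ū)_j = 0` and `P = 0`.
* `ρ_r = 0`: `p_hs(0, θ) = 0 = p_c(0, θ)` and `(σ³·0)⁺ = 0`, both sides vanish.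
Folklore finite-sum algebra; no source is cited (Chapman–Cowling 1970 §16.4 is the background for the
Enskog value, recorded on the imported tools). The finite-sum forms of `ρ_r, m_r, S` and `Σ_k S_kk = 2e_r`
are reused from `…JParityClosureParityBandClosurePressureValueAlgebra` (namespace
`ParityBandClosurePressureValue`) and `EvenStatTruncationBound`.
-/

namespace Summit.AtomisticToContinuum.HydrodynamicLimit.Theorems.HemisphereAffineSlaving

open scoped BigOperators Topology Classical ENNReal InnerProductSpace
open Filter Set Function MeasureTheory

noncomputable section

open Literature.MathematicalPhysics.KineticTheory (T3 V3)

namespace ConeValue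

open Literature.MathematicalPhysics.KineticTheory (coneKernel mollDensity mollMomentum mollKineticEnergy
  mollTemperature contactValue hsPressure hsCompressibility hsExcessFreeEnergy empiricalDensityField
  empiricalMomentumField empiricalEnergyField mollDensity_eq_avg mollDensity_nonneg_of_pos)
open Literature.Analysis.FluidPDE (empiricalMeasure integral_empiricalMeasure)
open ParityBandClosurePressureValue (coneKernel_nonneg' secondMoment_eq_sum mollMomentum_apply_eq_sum
  sum_secondMoment_diag)

variable {N : ℕ}

/-! ### Kernel identification: the cone block fields are the mollified fields -/

/-- The centred cone kernel read at the origin is the cone kernel: `b_r(y − x, 0) = b_r(y, x)`. [folklore] -/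
theorem coneKernel_sub_zero (r : ℝ) (y x : T3) : coneKernel r (y - x) 0 = coneKernel r y x := by
  unfold coneKernel Literature.Analysis.FluidPDE.Torus.euclidDist
  rw [sub_zero]

/-- `ρ̄ = ρ_r` for the cone block kernel. [folklore] -/
theorem rhoB_cone (r : ℝ) (N : ℕ) (w : Cfg N) (x : T3) :
    rhoB (fun (_ : ℕ) (y : T3) => coneKernel r y 0) N w x = mollDensity r w x := by
  unfold rhoB empiricalDensityField mollDensity
  simp_rw [coneKernel_sub_zero]

/-- `m̄ = m_r` for the cone block kernel. [folklore] -/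
theorem mB_cone (r : ℝ) (N : ℕ) (w : Cfg N) (x : T3) :
    mB (fun (_ : ℕ) (y : T3) => coneKernel r y 0) N w x = mollMomentum r w x := by
  unfold mB empiricalMomentumField mollMomentum
  simp_rw [coneKernel_sub_zero]

/-- `Ē = e_r` for the cone block kernel. [folklore] -/
theorem EB_cone (r : ℝ) (N : ℕ) (w : Cfg N) (x : T3) :
    EB (fun (_ : ℕ) (y : T3) => coneKernel r y 0) N w x = mollKineticEnergy r w x := by
  unfold EB empiricalEnergyField mollKineticEnergy
  simp_rw [coneKernel_sub_zero]

/-- `θ̄ = θ_r` for the cone block kernel. [folklore] -/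
theorem thetaB_cone (r : ℝ) (N : ℕ) (w : Cfg N) (x : T3) :
    thetaB (fun (_ : ℕ) (y : T3) => coneKernel r y 0) N w x = mollTemperature r w x := by
  unfold thetaB mollTemperature
  rw [rhoB_cone, mB_cone, EB_cone]

/-- `ū_j = (m_r)_j / ρ_r` (junk `0` on empty blocks) for the cone block kernel. [folklore] -/
theorem uB_cone_apply (r : ℝ) (N : ℕ) (w : Cfg N) (x : T3) (j : Fin 3) :
    uB (fun (_ : ℕ) (y : T3) => coneKernel r y 0) N w x j = (mollDensity r w x)⁻¹ * mollMomentum r w x j := by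
  rw [uB, rhoB_cone, mB_cone, PiLp.smul_apply, smul_eq_mul]

/-! ### Central moments of the cone block (finite empirical sums) -/

/-- Expansion of a weighted sum of products of centred coordinates. [folklore] -/
theorem sum_mul_sub_mul_sub {ι : Type*} (s : Finset ι) (b vj vk : ι → ℝ) (α β : ℝ) :
    ∑ i ∈ s, b i * ((vj i - α) * (vk i - β)) =
      ∑ i ∈ s, b i * (vj i * vk i) - β * ∑ i ∈ s, b i * vj i - α * ∑ i ∈ s, b i * vk i +
        α * β * ∑ i ∈ s, b i := by
  simp only [Finset.mul_sum, ← Finset.sum_sub_distrib, ← Finset.sum_add_distrib]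
  exact Finset.sum_congr rfl fun i _ => by ring

/-- **The block central second moments are the macroscale central tensor** (off empty blocks):
`∫ b_r (v_j − ū_j)(v_k − ū_k) dμ_w = S_jk − (m_r)_j (m_r)_k / ρ_r`, `ū = m_r/ρ_r`. [folklore] -/
theorem centralMoment_eq {r : ℝ} {w : Cfg N} {x : T3} (hρ : mollDensity r w x ≠ 0) (j k : Fin 3) :
    (∫ q, coneKernel r q.1 x * ((q.2 j - uB (fun (_ : ℕ) (y : T3) => coneKernel r y 0) N w x j) *
        (q.2 k - uB (fun (_ : ℕ) (y : T3) => coneKernel r y 0) N w x k)) ∂(empiricalMeasure w)) =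
      (∫ q, coneKernel r q.1 x * (q.2 j * q.2 k) ∂(empiricalMeasure w)) -
        mollMomentum r w x j * mollMomentum r w x k / mollDensity r w x := by
  simp only [uB_cone_apply]
  rw [integral_empiricalMeasure, secondMoment_eq_sum, sum_mul_sub_mul_sub, mollMomentum_apply_eq_sum,
    mollMomentum_apply_eq_sum]
  rw [mollDensity_eq_avg] at hρ ⊢
  have hX : ∑ i, coneKernel r (w i).1 x ≠ 0 := fun h => hρ (by rw [h, mul_zero])
  have hc : ((N + 1 : ℕ) : ℝ) ≠ 0 := by positivity
  field_simp
  ring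

/-- **Trace of the central tensor**: `Σ_l (S_ll − (m_r)_l²/ρ_r) = 2e_r − ‖m_r‖²/ρ_r = 3 ρ_r θ_r` (off empty
blocks). [folklore] -/
theorem sum_centralMoment_diag {r : ℝ} {w : Cfg N} {x : T3} (hρ : mollDensity r w x ≠ 0) :
    ∑ l, ((∫ q, coneKernel r q.1 x * (q.2 l * q.2 l) ∂(empiricalMeasure w)) -
        mollMomentum r w x l * mollMomentum r w x l / mollDensity r w x) =
      3 * (mollDensity r w x * mollTemperature r w x) := by
  rw [Finset.sum_sub_distrib, sum_secondMoment_diag, ← Finset.sum_div]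
  simp_rw [← pow_two]
  rw [← EuclideanSpace.real_norm_sq_eq]
  unfold mollTemperature
  field_simp

/-- **The guard `pkin = 0` on a nonempty block kills the central tensor**: if `ρ_r ≠ 0` and `ρ_r θ_r = 0`
then every diagonal central moment `∫ b_r (v_l − ū_l)² ≥ 0` vanishes (their sum is `3ρ_rθ_r = 0`), hence
every `b_r(xᵢ, x)(v_i − ū)_j = 0` and `S_jk − (m_r)_j (m_r)_k/ρ_r = 0`. [folklore] -/
theorem centralMoment_eq_zero {r : ℝ} (hr : 0 < r) {w : Cfg N} {x : T3} (hρ : mollDensity r w x ≠ 0)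
    (hp : mollDensity r w x * mollTemperature r w x = 0) (j k : Fin 3) :
    (∫ q, coneKernel r q.1 x * (q.2 j * q.2 k) ∂(empiricalMeasure w)) -
        mollMomentum r w x j * mollMomentum r w x k / mollDensity r w x = 0 := by
  have hB := sum_centralMoment_diag hρ
  rw [hp, mul_zero] at hB
  have hdiag : ∀ l, (∫ q, coneKernel r q.1 x * (q.2 l * q.2 l) ∂(empiricalMeasure w)) -
      mollMomentum r w x l * mollMomentum r w x l / mollDensity r w x =
      ((N + 1 : ℕ) : ℝ)⁻¹ * ∑ i, coneKernel r (w i).1 x *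
        (((w i).2 l - uB (fun (_ : ℕ) (y : T3) => coneKernel r y 0) N w x l) *
          ((w i).2 l - uB (fun (_ : ℕ) (y : T3) => coneKernel r y 0) N w x l)) := by
    intro l
    rw [← centralMoment_eq hρ l l, integral_empiricalMeasure]
  have hnn : ∀ (i : Fin (N + 1)) (l : Fin 3), 0 ≤ coneKernel r (w i).1 x *
      (((w i).2 l - uB (fun (_ : ℕ) (y : T3) => coneKernel r y 0) N w x l) *
        ((w i).2 l - uB (fun (_ : ℕ) (y : T3) => coneKernel r y 0) N w x l)) :=
    fun i l => mul_nonneg (coneKernel_nonneg' hr _ _) (mul_self_nonneg _)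
  have hl : ∀ l ∈ (Finset.univ : Finset (Fin 3)),
      0 ≤ (∫ q, coneKernel r q.1 x * (q.2 l * q.2 l) ∂(empiricalMeasure w)) -
        mollMomentum r w x l * mollMomentum r w x l / mollDensity r w x := fun l _ => by
    rw [hdiag]
    exact mul_nonneg (by positivity) (Finset.sum_nonneg fun i _ => hnn i l)
  have hz := (Finset.sum_eq_zero_iff_of_nonneg hl).1 hB j (Finset.mem_univ j)
  rw [hdiag] at hz
  have hc : (0 : ℝ) < ((N + 1 : ℕ) : ℝ)⁻¹ := by positivity
  have hs := (mul_eq_zero.1 hz).resolve_left hc.ne'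
  have hterm := (Finset.sum_eq_zero_iff_of_nonneg fun i _ => hnn i j).1 hs
  rw [← centralMoment_eq hρ j k, integral_empiricalMeasure]
  refine mul_eq_zero_of_right _ (Finset.sum_eq_zero fun i _ => ?_)
  rcases mul_eq_zero.1 (hterm i (Finset.mem_univ i)) with h | h
  · rw [h, zero_mul]
  · rw [mul_self_eq_zero.1 h, zero_mul, mul_zero]

/-- **Traceless pairing**: for `3 × 3` matrices `A, P` with `Σ_l P_ll = 3p`,
`Σ_jk A⁰_jk P_jk = Σ_ab (P_ab − p δ_ab) A_ab` (`A⁰ = A − (tr A/3)𝟙`; both sides equal `A : P − p tr A`). [folklore] -/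
theorem traceless_pairing (A P : Fin 3 → Fin 3 → ℝ) (p : ℝ) (hp : ∑ l, P l l = 3 * p) :
    ∑ j, ∑ k, (A j k - if j = k then (∑ i, A i i) / 3 else 0) * P j k =
      ∑ a, ∑ b, (P a b - if a = b then p else 0) * A a b := by
  simp only [Fin.sum_univ_three, Fin.isValue] at hp ⊢
  simp
  linear_combination (-(A 0 0 + A 1 1 + A 2 2) / 3) * hp

end ConeValue

open Literature.MathematicalPhysics.KineticTheory (coneKernel mollDensity mollMomentum mollTemperature
  contactValue hsPressure hsCompressibility mollDensity_nonneg_of_pos)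
open Literature.Analysis.FluidPDE (empiricalMeasure)
open ConeValue

/-- **Registered stub `stub_coneValue_eq` ([ConeVal]).** On cone-kernel block fields (block kernel
`φ_N := b_r(·, 0)`), the macroscale Enskog value integrand of `ParityBandClosurePressureValue` — trace part
`g(σ³ρ_r)(p_hs(ρ_r, θ_r) − ρ_rθ_r) tr A` plus traceless part `(4π/15)(σ³ρ_r)⁺ g Ỹ Σ A⁰_jk P_jk` — IS the
line's value integrand `g(σ³ρ̄)(trW A · p_c(ρ̄, θ̄) + kinWA A · p_c(ρ̄, θ̄))`, pointwise in `(s, w, x)`,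
for every cut-off `g` vanishing on `[η₀', ∞)` and every `Ỹ` equal to the contact value on `(0, η₁) ⊇ (0, η₀')`.
[folklore] -/
theorem stub_coneValue_eq : ∀ (σ r η₀' η₁ : ℝ) (Yt g : ℝ → ℝ), (∀ b ∈ Set.Ioo 0 η₁, Yt b = Literature.MathematicalPhysics.KineticTheory.contactValue b) → (∀ b, η₀' ≤ b → g b = 0) → η₀' ≤ η₁ → 0 < η₀' → 0 < σ → 0 < r → r < 1 / 2 → ∀ (A : ℝ → T3 → Fin 3 → Fin 3 → ℝ) (s : ℝ) (N : ℕ) (w : Cfg N) (x : T3), g (σ ^ 3 * Literature.MathematicalPhysics.KineticTheory.mollDensity r w x) * (Literature.MathematicalPhysics.KineticTheory.hsPressure σ (Literature.MathematicalPhysics.KineticTheory.mollDensity r w x) (Literature.MathematicalPhysics.KineticTheory.mollTemperature r w x) - Literature.MathematicalPhysics.KineticTheory.mollDensity r w x * Literature.MathematicalPhysics.KineticTheory.mollTemperature r w x) * (∑ k : Fin 3, A s x k k) + 4 * Real.pi / 15 * (max (σ ^ 3 * Literature.MathematicalPhysics.KineticTheory.mollDensity r w x) 0 * g (σ ^ 3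 * Literature.MathematicalPhysics.KineticTheory.mollDensity r w x) * Yt (σ ^ 3 * Literature.MathematicalPhysics.KineticTheory.mollDensity r w x) * ∑ j : Fin 3, ∑ k : Fin 3, (A s x j k - if j = k then (∑ i : Fin 3, A s x i i) / 3 else 0) * ((∫ q, Literature.MathematicalPhysics.KineticTheory.coneKernel r q.1 x * (q.2 j * q.2 k) ∂(Literature.Analysis.FluidPDE.empiricalMeasure w)) - Literature.MathematicalPhysics.KineticTheory.mollMomentum r w x j * Literature.MathematicalPhysics.KineticTheory.mollMomentum r w x k / Literature.MathematicalPhysics.KineticTheory.mollDensity r w x)) = g (σ ^ 3 * rhoB (fun (_ : ℕ) (y : T3) => Literature.MathematicalPhysics.KineticTheory.coneKernel r y 0) N w x) * (trW A s x * pcoll σ (rhoB (fun (_ : ℕ) (y : T3) => Literature.MathematicalPhysics.KineticTheory.coneKernel r y 0) N w x) (thetaB (fun (_ : ℕ) (y : T3) => Literature.MathematicalPhysics.KineticTheory.coneKernel r y 0) N w x) + kinWA A (fun (_ : ℕ) (y : T3) => Literature.MathematicalPhysics.KineticTheory.coneKernel r y 0) N s w x * pcoll σ (rhoB (fun (_ :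 ℕ) (y : T3) => Literature.MathematicalPhysics.KineticTheory.coneKernel r y 0) N w x) (thetaB (fun (_ : ℕ) (y : T3) => Literature.MathematicalPhysics.KineticTheory.coneKernel r y 0) N w x)) := by
  intro σ r η₀' η₁ Yt g hY hg hle _hη₀ hσ hr _hr2 A s N w x
  simp only [kinWA, pkin, trW, rhoB_cone, thetaB_cone]
  rcases eq_or_ne (mollDensity r w x) 0 with hρ0 | hρ
  · -- empty block: both sides vanish
    have h1 : hsPressure σ 0 (mollTemperature r w x) = 0 := by simp [hsPressure]
    have h2 : pcoll σ 0 (mollTemperature r w x) = 0 := by simp [pcoll, hsPressure]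
    rw [hρ0]
    simp [h1, h2]
  · -- nonempty block
    have hρpos : 0 < mollDensity r w x := (mollDensity_nonneg_of_pos hr w x).lt_of_ne' hρ
    have hB := sum_centralMoment_diag hρ
    -- the diagonal term of `Dst` is `pkin`
    have hdiag : (∑ l : Fin 3, ∫ y, coneKernel r y.1 x *
        (y.2 l - uB (fun (_ : ℕ) (y : T3) => coneKernel r y 0) N w x l) ^ 2 ∂(empiricalMeasure w)) / 3 =
        mollDensity r w x * mollTemperature r w x := by
      rw [div_eq_iff (by norm_num : (3 : ℝ) ≠ 0)]
      simp_rw [pow_two, centralMoment_eq hρ]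
      rw [hB]
      ring
    -- `D̄_ab = P_ab − pkin δ_ab`
    have hDst : ∀ a b, Dst (fun (_ : ℕ) (y : T3) => coneKernel r y 0) N w x a b =
        ((∫ q, coneKernel r q.1 x * (q.2 a * q.2 b) ∂(empiricalMeasure w)) -
            mollMomentum r w x a * mollMomentum r w x b / mollDensity r w x) -
          if a = b then mollDensity r w x * mollTemperature r w x else 0 := by
      intro a b
      unfold Dst
      simp only [coneKernel_sub_zero]
      rw [centralMoment_eq hρ, hdiag]
    -- `Σ A⁰_jk P_jk = Σ D̄_ab A_ab`
    have hXY : (∑ j : Fin 3, ∑ k : Fin 3, (A s x j k - if j = k then (∑ i : Fin 3, A s x i i) / 3 else 0) *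
        ((∫ q, coneKernel r q.1 x * (q.2 j * q.2 k) ∂(empiricalMeasure w)) -
          mollMomentum r w x j * mollMomentum r w x k / mollDensity r w x)) =
        ∑ a, ∑ b, Dst (fun (_ : ℕ) (y : T3) => coneKernel r y 0) N w x a b * A s x a b := by
      simp_rw [hDst]
      exact traceless_pairing (A s x) (fun j k => (∫ q, coneKernel r q.1 x * (q.2 j * q.2 k) ∂(empiricalMeasure w)) -
          mollMomentum r w x j * mollMomentum r w x k / mollDensity r w x)
        (mollDensity r w x * mollTemperature r w x) hB
    rw [hXY, max_eq_left (by positivity : (0 : ℝ) ≤ σ ^ 3 * mollDensity r w x)]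
    by_cases hga : g (σ ^ 3 * mollDensity r w x) = 0
    · rw [hga]
      ring
    · have hlt : σ ^ 3 * mollDensity r w x < η₀' := lt_of_not_ge fun h => hga (hg _ h)
      have hapos : 0 < σ ^ 3 * mollDensity r w x := by positivity
      rw [hY _ ⟨hapos, hlt.trans_le hle⟩]
      simp only [pcoll, hsPressure, hsCompressibility, contactValue]
      rw [mul_comm (mollDensity r w x) (σ ^ 3)]
      by_cases hp : mollDensity r w x * mollTemperature r w x = 0
      · -- the guard: `P = 0`, hence `Σ D̄ A = 0`
        have hY0 : ∑ a, ∑ b, Dst (fun (_ : ℕ) (y : T3) => coneKernel r y 0) N w x a b * A s x a b = 0 := by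
          refine Finset.sum_eq_zero fun a _ => Finset.sum_eq_zero fun b _ => ?_
          rw [hDst, centralMoment_eq_zero hr hρ hp, hp]
          simp
        rw [hY0]
        ring
      · have hθ : mollTemperature r w x ≠ 0 := fun h => hp (by rw [h, mul_zero])
        have hπ : Real.pi ≠ 0 := Real.pi_ne_zero
        field_simp
        ring

end

end Summit.AtomisticToContinuum.HydrodynamicLimit.Theorems.HemisphereAffineSlaving
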